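import Summits.ABC.ABC.Theses.DefiniteXi
import Literature.Barriers.ABC.SzpiroEpsilonCannotBeDroppedMasserProofs

/-!
# stub-ideation k3 gen 9 — closure audit of the plan for `stub_primeToSixDegreeBound` (P6)

Sanity only (planner seat, no proving beyond elaboration): (1) the registered stub signature VERBATIM
follows from the route target `FreyDegreeBound` by `cps n ≤ n` — this is the tree helper
`Summit.ABC.ABC.Theorems.SteinbergCorePrimeRung.primeToSixDegreeBound_of_freyDegreeBound` (p162616),
re-derived here over the route file alone so that the check does not depend on the PrimeRung import
closure (stale on the farm 2026-08-31T21–22Z); (2) the ε-free endpoint `StubZero` (k3 g4) implies the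
stub and sits next to the PROVED extremal family `Literature.Barriers.ABC.Masser.masser_theorem`, whose
excess `exp((24−δ)√log N/log log N)` is sub-power — invisible to the route's `N^{1−ε}` item
`PeterssonLowerBound` (gen-9 Family-3 note F3-A: κ = 2 is undecidable by extremal families either way).
-/

namespace Summit.ABC.ABC.Cruxes.SteinbergCore.StubIdeas3G9

open Summit.ABC.ABC.Theses.DefiniteXi

/-- The registered stub, verbatim (= `Sig.stub_primeToSixDegreeBound` of `Lines/p6_tamagawa_split.lean`). -/
def Stub : Prop :=
  ∀ ε : ℝ, 0 < ε → ∃ C : ℝ, ∀ a b : ℤ, IsCoprime a b → a * b * (a + b) ≠ 0 → ∀ (N : ℕ) [NeZero N], (Literature.NumberTheory.EllipticCurves.freyCurve a b).conductorNorm ℤ = N → ∀ D : Literature.NumberTheory.EllipticCurves.ModularForms.ModularParametrizationData (Literature.NumberTheory.EllipticCurves.freyCurve a b) N, (∀ D' : Literature.NumberTheory.EllipticCurves.ModularForms.ModularParametrizationData (Literature.NumberTheory.EllipticCurves.freyCurve a b) N, D.deg ≤ D'.deg) → ((D.deg / (ordProj[2] D.deg * ordProj[3] D.deg) : ℕ)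 : ℝ) ≤ C * (N : ℝ) ^ (2 + ε)

/-- H0 (= tree p162616 `primeToSixDegreeBound_of_freyDegreeBound`, re-derived over the route file):
the only implication INTO the stub. [folklore] -/
theorem stub_of_freyDegreeBound (hX : FreyDegreeBound) : Stub := by
  intro ε hε
  obtain ⟨C, hC⟩ := hX ε hε
  refine ⟨C, fun a b hab h0 N _ hN D hDmin => ?_⟩
  obtain ⟨D₀, hD₀⟩ := hC a b hab h0 N hN
  have h1 : ((D.deg / (ordProj[2] D.deg * ordProj[3] D.deg) : ℕ) : ℝ) ≤ (D.deg : ℝ) := by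
    exact_mod_cast Nat.div_le_self _ _
  have h2 : (D.deg : ℝ) ≤ (D₀.deg : ℝ) := by exact_mod_cast hDmin D₀
  exact h1.trans (h2.trans hD₀)

/-- The ε-free endpoint (κ = 2; k3 g4/g5 `StubZero`): undecided — see F3-A of the gen-9 card. -/
def StubZero : Prop :=
  ∃ C : ℝ, ∀ a b : ℤ, IsCoprime a b → a * b * (a + b) ≠ 0 → ∀ (N : ℕ) [NeZero N], (Literature.NumberTheory.EllipticCurves.freyCurve a b).conductorNorm ℤ = N → ∀ D : Literature.NumberTheory.EllipticCurves.ModularForms.ModularParametrizationData (Literature.NumberTheory.EllipticCurves.freyCurve a b) N, (∀ D' : Literature.NumberTheory.EllipticCurves.ModularForms.ModularParametrizationData (Literature.NumberTheory.EllipticCurves.freyCurve a b) N, D.deg ≤ D'.deg) → ((D.deg / (ordProj[2] D.deg * ordProj[3] D.deg) : ℕ) : ℝ) ≤ C * (N : ℝ) ^ (2 : ℝ)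

/-- `StubZero → Stub` (monotonicity in the exponent; `N ≥ 1`). [folklore] -/
theorem stub_of_stubZero (h : StubZero) : Stub := by
  intro ε hε
  obtain ⟨C, hC⟩ := h
  refine ⟨max C 0, fun a b hab h0 N _ hN D hD => ?_⟩
  have h1 := hC a b hab h0 N hN D hD
  have hN1 : (1 : ℝ) ≤ (N : ℝ) := by exact_mod_cast Nat.one_le_iff_ne_zero.mpr (NeZero.ne N)
  have hpow : (N : ℝ) ^ (2 : ℝ) ≤ (N : ℝ) ^ (2 + ε) :=
    Real.rpow_le_rpow_of_exponent_le hN1 (by linarith)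
  calc ((D.deg / (ordProj[2] D.deg * ordProj[3] D.deg) : ℕ) : ℝ) ≤ C * (N : ℝ) ^ (2 : ℝ) := h1
    _ ≤ max C 0 * (N : ℝ) ^ (2 : ℝ) :=
        mul_le_mul_of_nonneg_right (le_max_left _ _) (by positivity)
    _ ≤ max C 0 * (N : ℝ) ^ (2 + ε) :=
        mul_le_mul_of_nonneg_left hpow (le_max_right _ _)

/-- The extremal family is a THEOREM of the tree (Masser 1990: semistable curves — built from Frey curves of
`y`-smooth Stewart–Tijdeman triples, `y = √log x` — with sub-power Szpiro excess). -/
example (δ : ℝ) (hδ : 0 < δ) (N₀ : ℕ) :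
    ∃ W : WeierstrassCurve ℚ, W.IsElliptic ∧ W.IsSemistable ℤ ∧ N₀ < W.conductorNorm ℤ ∧
      (W.conductorNorm ℤ : ℝ) ^ 6 *
          Real.exp ((24 - δ) * Real.log (W.conductorNorm ℤ) ^ (1 / 2 : ℝ) *
            (Real.log (Real.log (W.conductorNorm ℤ)))⁻¹) ≤
        (W.minimalDiscriminantNorm ℤ : ℝ) :=
  Literature.Barriers.ABC.Masser.masser_theorem δ hδ N₀

end Summit.ABC.ABC.Cruxes.SteinbergCore.StubIdeas3G9
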